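import Literature.AnabelianGeometry.AbsoluteAnabelian.AbsTopIII.FrobeniusPictureMLFCores

/-!
# [AbsTopIII] Corollary 3.6 (v), second half DISCHARGED: the `ℤ`-action by nexus-classes of
# self-equivalences

S. Mochizuki, *Topics in Absolute Anabelian Geometry III*, Cor. 3.6 (v) p. 80 (manuscript
`paper:url-5493eb38cbb7`; bib key `MochizukiAbsTopIII2015`): "the natural action of `ℤ` on the
infinite linear oriented graph `Γ⃗_{𝒟_{≤1}}` extends to an action of `ℤ` on `𝒟` by nexus-classes of
self-equivalences of `𝒟`" (proof, p. 82: "The remainder of assertion (v) follows immediately from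
the definitions").  Over the ABSTRACT input `Δ : LogFrobeniusData` (seat abc-iut-L4-t2's
`LogFrobeniusDiagram.lean`) this is indeed definitional bookkeeping: translation by `m` on the first
row of the quiver `LFVertex` (`LFVertex.shift`), identity functors at every vertex (all first-row
vertices carry the same category `X₁` and the same edge functor `log`), unitor 2-cells.  We build
these nexus self-equivalences (Def. 3.5 (v), (vi), seat abc-iut-L4-t2's `DiagramMorphisms.lean`)
and PROVE the typed statement `LogFrobeniusData.ShiftStmt` of `FrobeniusPictureMLF.lean` —
including the action law `Φ_0 ≅ id`, `Φ_m ∘ Φ_{m'} ≅ Φ_{m+m'}` — for EVERY `Δ` (hence also for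
Cor. 4.5 (v), which is the same statement on archimedean data).  Nothing here takes a side on
inter-universal Teichmüller theory.
-/

namespace Literature.AnabelianGeometry.AbsoluteAnabelian

open _root_.CategoryTheory _root_.Quiver

universe u w

/-! ### Translation of the first row of `Γ⃗_𝒟` -/

namespace LFVertex

/-- Translation by `m` on the first row, identity on rows 2–6 (vertices).
[cite: MochizukiAbsTopIII2015, Corollary 3.6 (v) p.80] -/
@[reducible] def shiftObj (m : ℤ) : LFVertex → LFVertex
  | row1 n => row1 (n + m)
  | nexus => nexus
  | third => third
  | fourth => fourth
  | fifth => fifth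
  | sixth => sixth

/-- Translation by `m` on the first row (edges): `log : ⋎+1 → ⋎` goes to `log : ⋎+1+m → ⋎+m`,
`id_⋎` to `id_{⋎+m}`, the other edges are fixed. [cite: MochizukiAbsTopIII2015, Corollary 3.6 (v) p.80] -/
def shiftHom (m : ℤ) : ∀ {a b : LFVertex}, (a ⟶ b) → (shiftObj m a ⟶ shiftObj m b)
  | .row1 _, .row1 _, e => ULift.up (PLift.up (by have h := e.down.down; omega))
  | .row1 _, .nexus, e => e
  | .nexus, .third, e => e
  | .third, .fourth, e => e
  | .fourth, .fifth, e => e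
  | .fifth, .sixth, e => e
    | .row1 _, .third, e => PEmpty.elim e
    | .row1 _, .fourth, e => PEmpty.elim e
    | .row1 _, .fifth, e => PEmpty.elim e
    | .row1 _, .sixth, e => PEmpty.elim e
    | .nexus, .row1 _, e => PEmpty.elim e
    | .nexus, .nexus, e => PEmpty.elim e
    | .nexus, .fourth, e => PEmpty.elim e
    | .nexus, .fifth, e => PEmpty.elim e
    | .nexus, .sixth, e => PEmpty.elim e
    | .third, .row1 _, e => PEmpty.elim e
    | .third, .nexus, e => PEmpty.elim e
    | .third, .third, e => PEmpty.elim e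
    | .third, .fifth, e => PEmpty.elim e
    | .third, .sixth, e => PEmpty.elim e
    | .fourth, .row1 _, e => PEmpty.elim e
    | .fourth, .nexus, e => PEmpty.elim e
    | .fourth, .third, e => PEmpty.elim e
    | .fourth, .fourth, e => PEmpty.elim e
    | .fourth, .sixth, e => PEmpty.elim e
    | .fifth, .row1 _, e => PEmpty.elim e
    | .fifth, .nexus, e => PEmpty.elim e
    | .fifth, .third, e => PEmpty.elim e
    | .fifth, .fourth, e => PEmpty.elim e
    | .fifth, .fifth, e => PEmpty.elim e
    | .sixth, .row1 _, e => PEmpty.elim e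
    | .sixth, .nexus, e => PEmpty.elim e
    | .sixth, .third, e => PEmpty.elim e
    | .sixth, .fourth, e => PEmpty.elim e
    | .sixth, .fifth, e => PEmpty.elim e
    | .sixth, .sixth, e => PEmpty.elim e

/-- "The natural action of `ℤ` on the infinite linear oriented graph `Γ⃗_{𝒟_{≤1}}`", extended by the
identity to `Γ⃗_𝒟`, as a morphism of quivers. [cite: MochizukiAbsTopIII2015, Corollary 3.6 (v) p.80] -/
@[reducible] def shift (m : ℤ) : LFVertex ⥤q LFVertex where
  obj := shiftObj m
  map e := shiftHom.{w} m e

/-- `shift m ⋙ shift m' = shift (m + m')` (the action law on the graph). [cite: MochizukiAbsTopIII2015, Corollary 3.6 (v) p.80] -/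
theorem shift_comp (m m' : ℤ) : shift.{w} m ⋙q shift.{w} m' = shift.{w} (m + m') := by
  refine Prefunctor.ext (fun X => ?_) (fun X Y f => ?_)
  · cases X <;> simp [shiftObj, Int.add_assoc]
  · cases X <;> cases Y <;>
      first
        | exact (PEmpty.elim f)
        | exact Subsingleton.elim _ _
        | rfl

/-- `shift 0 = id`. [cite: MochizukiAbsTopIII2015, Corollary 3.6 (v) p.80] -/
theorem shift_zero : shift.{w} 0 = 𝟭q LFVertex := by
  refine Prefunctor.ext (fun X => ?_) (fun X Y f => ?_)
  · cases X <;> simp [shiftObj]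
  · cases X <;> cases Y <;>
      first
        | exact (PEmpty.elim f)
        | exact Subsingleton.elim _ _
        | rfl

/-- `shift m ⋙ shift (-m) = id`. [cite: MochizukiAbsTopIII2015, Corollary 3.6 (v) p.80] -/
theorem shift_comp_neg (m : ℤ) : shift.{w} m ⋙q shift.{w} (-m) = 𝟭q LFVertex := by
  rw [shift_comp, Int.add_right_neg, shift_zero]

/-- `shift (-m) ⋙ shift m = id`. [cite: MochizukiAbsTopIII2015, Corollary 3.6 (v) p.80] -/
theorem shift_neg_comp (m : ℤ) : shift.{w} (-m) ⋙q shift.{w} m = 𝟭q LFVertex := by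
  rw [shift_comp, Int.add_left_neg, shift_zero]

end LFVertex

/-! ### A transport lemma for 1-morphisms of diagrams of categories -/

namespace DiagramOfCategories

universe v' u' w'

variable {V : Type w'} [Quiver.{v'} V] {V' : Type w'} [Quiver.{v'} V']
  {D : DiagramOfCategories.{v', u', w'} V} {D' : DiagramOfCategories.{v', u', w'} V'}

/-- Two 1-morphisms of diagrams of categories over EQUAL morphisms of graphs, with the same functors
at every vertex and whose edge isomorphisms have `eqToHom` components, are 2-isomorphic after
transport along the equality of graph morphisms (the situation of Def. 3.5 (v)'s "Ψ ∘ Φ, Φ ∘ Ψ are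
isomorphic to the respective identity 1-morphisms" for 1-morphisms built from identity functors).
[cite: MochizukiAbsTopIII2015, Definition 3.5 (v) p.76] -/
theorem OneMorphism.isomorphic_transport {F₁ F₂ : V ⥤q V'} (h : F₁ = F₂) (Φ : OneMorphism F₁ D D')
    (Ψ : OneMorphism F₂ D D') (happ : ∀ a, HEq (Φ.app a) (Ψ.app a))
    (hΦ : ∀ ⦃a b : V⦄ (e : a ⟶ b) (x : D.obj a), ∃ h', (Φ.iso e).hom.app x = eqToHom h')
    (hΨ : ∀ ⦃a b : V⦄ (e : a ⟶ b) (x : D.obj a), ∃ h', (Ψ.iso e).hom.app x = eqToHom h') :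
    (h ▸ Φ).Isomorphic Ψ := by
  subst h
  have happ' : ∀ a, Φ.app a = Ψ.app a := fun a => eq_of_heq (happ a)
  change Φ.Isomorphic Ψ
  refine ⟨⟨fun a => eqToHom (happ' a), ?_⟩, fun a => ?_⟩
  · intro a b e
    ext x
    obtain ⟨h1, e1⟩ := hΦ e x
    obtain ⟨h2, e2⟩ := hΨ e x
    simp only [NatTrans.comp_app, Functor.whiskerRight_app, Functor.whiskerLeft_app, eqToHom_app,
      eqToHom_map, e1, e2]
    exact (eqToHom_trans _ _).trans (eqToHom_trans _ _).symm
  · change IsIso (eqToHom (happ' a))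
    infer_instance

end DiagramOfCategories

/-! ### The nexus self-equivalences of `𝒟` -/

namespace LogFrobeniusData

open DiagramOfCategories

variable (Δ : LogFrobeniusData.{u})

/-- The functor of the shift self-equivalence at each vertex: the identity (every first-row vertex
carries the same category `𝒳`, resp. `X₁`). [cite: MochizukiAbsTopIII2015, Corollary 3.6 (v) p.80] -/
def shiftApp (m : ℤ) : ∀ a : LFVertex, Δ.diagram.obj a ⥤ Δ.diagram.obj (LFVertex.shiftObj m a)
  | .row1 _ => 𝟭 Δ.X₁
  | .nexus => 𝟭 Δ.X
  | .third => 𝟭 Δ.N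
  | .fourth => 𝟭 Δ.E
  | .fifth => 𝟭 Δ.A
  | .sixth => 𝟭 Δ.E

/-- The 2-cells of the shift self-equivalence: unitors (the shifted edge carries the same functor).
[cite: MochizukiAbsTopIII2015, Corollary 3.6 (v) p.80] -/
def shiftIso (m : ℤ) : ∀ {a b : LFVertex} (e : a ⟶ b),
    Δ.shiftApp m a ⋙ Δ.diagram.map (LFVertex.shiftHom m e) ≅ Δ.diagram.map e ⋙ Δ.shiftApp m b
  | .row1 _, .row1 _, _ => Δ.log.leftUnitor ≪≫ Δ.log.rightUnitor.symm
  | .row1 _, .nexus, _ => Δ.toNexus.leftUnitor ≪≫ Δ.toNexus.rightUnitor.symm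
  | .nexus, .third, e => (Δ.diagram.map e).leftUnitor ≪≫ (Δ.diagram.map e).rightUnitor.symm
  | .third, .fourth, _ => Δ.NtoE.leftUnitor ≪≫ Δ.NtoE.rightUnitor.symm
  | .fourth, .fifth, _ => Δ.κ.leftUnitor ≪≫ Δ.κ.rightUnitor.symm
  | .fifth, .sixth, _ => Δ.AtoE.leftUnitor ≪≫ Δ.AtoE.rightUnitor.symm
    | .row1 _, .third, e => PEmpty.elim e
    | .row1 _, .fourth, e => PEmpty.elim e
    | .row1 _, .fifth, e => PEmpty.elim e
    | .row1 _, .sixth, e => PEmpty.elim e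
    | .nexus, .row1 _, e => PEmpty.elim e
    | .nexus, .nexus, e => PEmpty.elim e
    | .nexus, .fourth, e => PEmpty.elim e
    | .nexus, .fifth, e => PEmpty.elim e
    | .nexus, .sixth, e => PEmpty.elim e
    | .third, .row1 _, e => PEmpty.elim e
    | .third, .nexus, e => PEmpty.elim e
    | .third, .third, e => PEmpty.elim e
    | .third, .fifth, e => PEmpty.elim e
    | .third, .sixth, e => PEmpty.elim e
    | .fourth, .row1 _, e => PEmpty.elim e
    | .fourth, .nexus, e => PEmpty.elim e
    | .fourth, .third, e => PEmpty.elim e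
    | .fourth, .fourth, e => PEmpty.elim e
    | .fourth, .sixth, e => PEmpty.elim e
    | .fifth, .row1 _, e => PEmpty.elim e
    | .fifth, .nexus, e => PEmpty.elim e
    | .fifth, .third, e => PEmpty.elim e
    | .fifth, .fourth, e => PEmpty.elim e
    | .fifth, .fifth, e => PEmpty.elim e
    | .sixth, .row1 _, e => PEmpty.elim e
    | .sixth, .nexus, e => PEmpty.elim e
    | .sixth, .third, e => PEmpty.elim e
    | .sixth, .fourth, e => PEmpty.elim e
    | .sixth, .fifth, e => PEmpty.elim e
    | .sixth, .sixth, e => PEmpty.elim e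

/-- The shift 1-morphism `Φ_m : 𝒟 → 𝒟` over `LFVertex.shift m` (Def. 3.5 (v), (vi): the nexus
self-equivalence of `𝒟` translating the first row by `m`). [cite: MochizukiAbsTopIII2015, Corollary 3.6 (v) p.80] -/
def shiftMor (m : ℤ) : OneMorphism (LFVertex.shift m) Δ.diagram Δ.diagram where
  app := Δ.shiftApp m
  iso e := Δ.shiftIso m e

/-- The vertex functors of `Φ_m` are identities. [cite: MochizukiAbsTopIII2015, Corollary 3.6 (v) p.80] -/
theorem shiftApp_heq_id (m : ℤ) (a : LFVertex) : HEq (Δ.shiftApp m a) (𝟭 (Δ.diagram.obj a)) := by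
  cases a <;> exact HEq.rfl

/-- The vertex functors of `Φ_m ∘ Φ_{m'}` are those of `Φ_{m+m'}`. [cite: MochizukiAbsTopIII2015, Corollary 3.6 (v) p.80] -/
theorem shiftMor_comp_app_heq (m m' : ℤ) (a : LFVertex) :
    HEq (((Δ.shiftMor m).comp (Δ.shiftMor m')).app a) ((Δ.shiftMor (m + m')).app a) := by
  cases a <;> exact HEq.rfl

/-- The 2-cells of `Φ_m` have identity components. [cite: MochizukiAbsTopIII2015, Corollary 3.6 (v) p.80] -/
theorem shiftMor_iso_app (m : ℤ) : ∀ ⦃a b : LFVertex⦄ (e : a ⟶ b) (x : Δ.diagram.obj a),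
    ∃ h, ((Δ.shiftMor m).iso e).hom.app x = eqToHom h := by
  intro a b e x
  cases a <;> cases b <;>
    first
      | exact (PEmpty.elim e)
      | exact ⟨rfl, by
          simp only [shiftMor, shiftIso, Iso.trans_hom, Iso.symm_hom, NatTrans.comp_app,
            Functor.leftUnitor_hom_app, Functor.rightUnitor_inv_app]
          erw [Category.comp_id]
          rfl⟩

/-- The 2-cells of `Φ_m ∘ Φ_{m'}` have identity components. [cite: MochizukiAbsTopIII2015, Corollary 3.6 (v) p.80] -/
theorem shiftMor_comp_iso_app (m m' : ℤ) : ∀ ⦃a b : LFVertex⦄ (e : a ⟶ b) (x : Δ.diagram.obj a),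
    ∃ h, (((Δ.shiftMor m).comp (Δ.shiftMor m')).iso e).hom.app x = eqToHom h := by
  intro a b e x
  obtain ⟨h1, e1⟩ := Δ.shiftMor_iso_app m e x
  obtain ⟨h2, e2⟩ := Δ.shiftMor_iso_app m' ((LFVertex.shift m).map e) (((Δ.shiftMor m).app a).obj x)
  refine ⟨?_, ?_⟩
  swap
  · simp only [OneMorphism.comp, Iso.trans_hom, Iso.symm_hom, NatTrans.comp_app,
      Functor.associator_hom_app, Functor.associator_inv_app, Functor.isoWhiskerLeft_hom,
      Functor.isoWhiskerRight_hom, Functor.whiskerLeft_app, Functor.whiskerRight_app, e1, e2,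
      eqToHom_map]
    repeat erw [Category.id_comp]
    repeat erw [Category.comp_id]
    exact eqToHom_trans _ _

/-- The identity 1-morphism has identity 2-cells. [folklore] -/
private theorem id_iso_app : ∀ ⦃a b : LFVertex⦄ (e : a ⟶ b) (x : Δ.diagram.obj a),
    ∃ h, ((OneMorphism.id Δ.diagram).iso e).hom.app x = eqToHom h := by
  intro a b e x
  exact ⟨rfl, by
    simp only [OneMorphism.id, Iso.trans_hom, Iso.symm_hom, NatTrans.comp_app,
      Functor.leftUnitor_hom_app, Functor.rightUnitor_inv_app]
    erw [Category.comp_id]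
    rfl⟩

/-- `Φ_m` is an equivalence of diagrams of categories (quasi-inverse `Φ_{-m}`).
[cite: MochizukiAbsTopIII2015, Corollary 3.6 (v) p.80] -/
theorem shiftMor_isEquivalence (m : ℤ) : (Δ.shiftMor m).IsEquivalence := by
  refine ⟨LFVertex.shift (-m), Δ.shiftMor (-m), LFVertex.shift_comp_neg m, LFVertex.shift_neg_comp m,
    ?_, ?_⟩
  · refine OneMorphism.isomorphic_transport _ _ _ (fun a => ?_) (Δ.shiftMor_comp_iso_app m (-m))
      Δ.id_iso_app
    cases a <;> exact HEq.rfl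
  · refine OneMorphism.isomorphic_transport _ _ _ (fun a => ?_) (Δ.shiftMor_comp_iso_app (-m) m)
      Δ.id_iso_app
    cases a <;> exact HEq.rfl

/-- The nexus self-equivalence `Φ_m` of `𝒟`. [cite: MochizukiAbsTopIII2015, Corollary 3.6 (v) p.80] -/
def shiftEquiv (m : ℤ) : Δ.diagram.SelfEquivalence :=
  ⟨LFVertex.shift m, Δ.shiftMor m, Δ.shiftMor_isEquivalence m⟩

/-- `Φ_m` is a nexus self-equivalence relative to `□` (Def. 3.5 (vi): identity on the post-nexus
portion, the first row mapped to itself). [cite: MochizukiAbsTopIII2015, Corollary 3.6 (v) p.80] -/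
theorem shiftEquiv_isNexusClass (m : ℤ) :
    (Δ.shiftEquiv m).IsNexusClass .nexus {a : LFVertex | a.row = 1} where
  isNexus := isNexus_nexus
  maps_pre a ha := by
    cases a <;> simp [shiftEquiv, LFVertex.shiftObj, LFVertex.row] at ha ⊢
  obj_eq_of_not_mem a ha := by
    cases a <;> simp [LFVertex.row] at ha <;> rfl
  map_heq_of_not_mem a b e ha hb := by
    cases a <;> cases b <;> simp [LFVertex.row] at ha hb <;>
      first
        | exact (PEmpty.elim e)
        | exact HEq.rfl
  app_heq_id a _ _ := Δ.shiftApp_heq_id m a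
  obj_nexus := rfl
  app_nexus_iso_id := ⟨𝟭 Δ.X, HEq.rfl, ⟨Iso.refl _⟩⟩

/-- **Cor. 3.6 (v), second half, PROVED over the abstract data**: `ℤ` acts on `𝒟` by nexus-classes
of self-equivalences translating the first row (with `Φ_0 ≅ id` and `Φ_m ∘ Φ_{m'} ≅ Φ_{m+m'}` up to
2-isomorphism). [cite: MochizukiAbsTopIII2015, Corollary 3.6 (v) p.80] -/
theorem shiftStmt : Δ.ShiftStmt := by
  refine ⟨Δ.shiftEquiv, Δ.shiftEquiv_isNexusClass, fun m n => rfl, ⟨LFVertex.shift_zero, ?_⟩,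
    fun m m' => ⟨LFVertex.shift_comp m m', ?_⟩⟩
  · exact OneMorphism.isomorphic_transport _ _ _ (Δ.shiftApp_heq_id 0) (Δ.shiftMor_iso_app 0)
      Δ.id_iso_app
  · exact OneMorphism.isomorphic_transport _ _ _ (Δ.shiftMor_comp_app_heq m m')
      (Δ.shiftMor_comp_iso_app m m') (Δ.shiftMor_iso_app (m + m'))

end LogFrobeniusData

end Literature.AnabelianGeometry.AbsoluteAnabelian
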